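import Summits.Ventures.QEC.CircuitDistance.ETowerZero
import HarnessLib

/-!
# P3-PORT STEP 2 (E-fold tower): the TOP predicate, logical-parity invariance data, and the INDUCTION LEMMAS of the nested
# tower (CARD-7 §5 induction paragraph, PORT-SPEC «TOWER ⇒ KC»; cell `qec`, experiment CDX, seat qec-cdx-type-1)

The nested tower has no intermediate class lists: level `k`'s continuation is level `k−1`'s node, so the invariant carried
is a PROPERTY of small words, `N_k v := GoodFibK (step k) col_{k−1} W N_{k−1} v`, down to the top predicate
`QTop u := (kerK syn u → kerK lg u) ∨ MatchedK … TOPS u` (what `ktop` certifies on a kernel word: all logical parities vanish,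
or an anchored translate is a listed class).  This file: (i) `LgId` — the logical-parity table under a torus generator is a
combination of itself and the syndrome table (`lg (transIdx J) = M·lg J ⊕ N·syn J`, data, decided per sector), whence on
kernel words «all parities zero» is translation invariant (`lgZero_transWK_iff`) and `QTop` is closed under un-translating
(`qTop_of_transWK`); (ii) `level_sound` — the induction step (a property of all small kernel words of weight `≤ W` that is a
fibre property lifts to all big kernel words of weight `≤ W`, by S2); (iii) `base_sound` — the base from a base certificate
(`s = 0 ∨ MatchedK T s`), the unit facts at the listed `t`, and the zero fibre; (iv) `goodFibK_of_matched` — transport of a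
fibre property from a representative (for the special weight-3 classes certified by windows).  Generic; no data.
-/

namespace Summit.Ventures.QEC.CircuitDistance.ETower

open Summit.Ventures.QEC.Census Summit.Ventures.QEC.Census.Fold

/-! ## Logical parities under translation (data) -/

/-- LOGICAL-PARITY INVARIANCE AS DATA: `lg (transIdx da db J) = M · lg J ⊕ N · syn J` (row masks `M`, `N`). -/
def LgId (lg syn : ℕ → ℕ) (l m n da db : ℕ) (M N : List ℕ) : Prop :=
  ∀ J, J < n → lg (transIdx l m da db J) = selXor M (lg J) ^^^ selXor N (syn J)

/-- The Bool form of `LgId`. -/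
def lgIdCheck (lg syn : ℕ → ℕ) (l m n da db : ℕ) (M N : List ℕ) : Bool :=
  (List.range n).all fun J => lg (transIdx l m da db J) == (selXor M (lg J) ^^^ selXor N (syn J))

/-- `lgIdCheck` decides `LgId`. -/
theorem lgId_of_check {lg syn : ℕ → ℕ} {l m n da db : ℕ} {M N : List ℕ} (h : lgIdCheck lg syn l m n da db M N = true) :
    LgId lg syn l m n da db M N := by
  intro J hJ
  unfold lgIdCheck at h
  rw [List.all_eq_true] at h
  have := h J (List.mem_range.2 hJ)
  rwa [beq_iff_eq] at this

section Lg

variable {l m : ℕ} (hl : 0 < l) (hm : 0 < m)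
include hl hm

/-- Logical parities of a translated word. -/
theorem lin_lg_transWK {lg syn : ℕ → ℕ} {nb da db : ℕ} {M N : List ℕ} (hL : LgId lg syn l m (nb * (l * m)) da db M N)
    (u : ℕ) : lin lg (nb * (l * m)) 0 (transWK l m nb da db u) =
      selXor M (lin lg (nb * (l * m)) 0 u) ^^^ selXor N (lin syn (nb * (l * m)) 0 u) := by
  rw [transWK, lin_lin, map_lin_of_xor (selXor M) (selXor_zero M) (selXor_xor M),
    map_lin_of_xor (selXor N) (selXor_zero N) (selXor_xor N), ← lin_xor_fun]
  exact lin_congr (i0 := 0) (fun J hJ => by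
    rw [Nat.zero_add, lin_two_pow _ _ 0 _ (transIdx_ltK hl hm nb da db hJ), Nat.zero_add, hL J hJ]) u

/-- One translation with data preserves «kernel word with all parities zero». -/
theorem lgZero_transWK_of_lgId {lg syn : ℕ → ℕ} {nb da db : ℕ} {M N : List ℕ}
    (hL : LgId lg syn l m (nb * (l * m)) da db M N) {u : ℕ} (hker : kerK syn (nb * (l * m)) u)
    (hlg : kerK lg (nb * (l * m)) u) : kerK lg (nb * (l * m)) (transWK l m nb da db u) := by
  unfold kerK at hker hlg ⊢
  rw [lin_lg_transWK hl hm hL, hker, hlg, selXor_zero, selXor_zero, Nat.xor_zero]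

/-- All translations preserve «kernel word with all parities zero», from the generator data. -/
theorem lgZero_transWK_of_gens {lg syn : ℕ → ℕ} {nb : ℕ} {Qx Qy Mx Nx My Ny : List ℕ}
    (hQx : QId syn l m (nb * (l * m)) 1 0 Qx) (hQy : QId syn l m (nb * (l * m)) 0 1 Qy)
    (hLx : LgId lg syn l m (nb * (l * m)) 1 0 Mx Nx) (hLy : LgId lg syn l m (nb * (l * m)) 0 1 My Ny) :
    ∀ (da db u : ℕ), kerK syn (nb * (l * m)) u → kerK lg (nb * (l * m)) u →
      kerK lg (nb * (l * m)) (transWK l m nb da db u) := by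
  intro da
  induction da with
  | zero =>
    intro db
    induction db with
    | zero =>
      intro u _ hlg
      unfold kerK at hlg ⊢
      rw [transWK_zero_eq_mod hl hm, lin_mod, hlg]
    | succ db ih =>
      intro u hker hlg
      rw [show (0 : ℕ) = 0 + 0 from rfl, show db + 1 = 1 + db from Nat.add_comm _ _, ← transWK_transWK hl hm]
      exact lgZero_transWK_of_lgId hl hm hLy (kerK_transWK_of_gens hl hm hQx hQy 0 db u hker) (ih u hker hlg)
  | succ da ih =>
    intro db u hker hlg
    rw [show da + 1 = 1 + da from Nat.add_comm _ _, show db = 0 + db from (Nat.zero_add _).symm, ← transWK_transWK hl hm]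
    exact lgZero_transWK_of_lgId hl hm hLx (kerK_transWK_of_gens hl hm hQx hQy da db u hker) (ih db u hker hlg)

/-- **On kernel words, «all logical parities zero» is translation invariant** (both directions on the window). -/
theorem lgZero_transWK_iff {lg syn : ℕ → ℕ} {nb : ℕ} {Qx Qy Mx Nx My Ny : List ℕ}
    (hQx : QId syn l m (nb * (l * m)) 1 0 Qx) (hQy : QId syn l m (nb * (l * m)) 0 1 Qy)
    (hLx : LgId lg syn l m (nb * (l * m)) 1 0 Mx Nx) (hLy : LgId lg syn l m (nb * (l * m)) 0 1 My Ny)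
    (da db : ℕ) {u : ℕ} (hu : u < 2 ^ (nb * (l * m))) (hker : kerK syn (nb * (l * m)) u) :
    kerK lg (nb * (l * m)) u ↔ kerK lg (nb * (l * m)) (transWK l m nb da db u) := by
  refine ⟨lgZero_transWK_of_gens hl hm hQx hQy hLx hLy da db u hker, fun h => ?_⟩
  have hker' := kerK_transWK_of_gens hl hm hQx hQy da db u hker
  have := lgZero_transWK_of_gens hl hm hQx hQy hLx hLy (l - da % l) (m - db % m) _ hker' h
  rwa [transWK_inv hl hm nb hu] at this

end Lg

/-! ## The top predicate -/

/-- The TOP PREDICATE of a big word: «if it is a kernel word, all its logical parities vanish», or an anchored translate is a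
listed class. -/
def QTop (l m nb : ℕ) (syn lg : ℕ → ℕ) (TOPS : List ℕ) (u : ℕ) : Prop :=
  (kerK syn (nb * (l * m)) u → kerK lg (nb * (l * m)) u) ∨ MatchedK l m nb TOPS u

section Top

variable {l m : ℕ} (hl : 0 < l) (hm : 0 < m)
include hl hm

omit hl hm in
/-- `transWK` reads its argument modulo the window. -/
theorem transWK_mod_two_pow (nb da db u : ℕ) : transWK l m nb da db (u % 2 ^ (nb * (l * m))) = transWK l m nb da db u :=
  lin_mod _ _ _ _

/-- **`QTop` is closed under un-translating** (from the syndrome and logical-parity generator data). -/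
theorem qTop_of_transWK {syn lg : ℕ → ℕ} {nb : ℕ} {Qx Qy Mx Nx My Ny : List ℕ} {TOPS : List ℕ}
    (hQx : QId syn l m (nb * (l * m)) 1 0 Qx) (hQy : QId syn l m (nb * (l * m)) 0 1 Qy)
    (hLx : LgId lg syn l m (nb * (l * m)) 1 0 Mx Nx) (hLy : LgId lg syn l m (nb * (l * m)) 0 1 My Ny) :
    ∀ (da db u : ℕ), QTop l m nb syn lg TOPS (transWK l m nb da db u) → QTop l m nb syn lg TOPS u := by
  intro da db u h
  rcases h with h | h
  · left
    intro hker
    -- reduce to the window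
    set u' := u % 2 ^ (nb * (l * m)) with hu'
    have hu'lt : u' < 2 ^ (nb * (l * m)) := Nat.mod_lt _ (Nat.two_pow_pos _)
    have hker' : kerK syn (nb * (l * m)) u' := by unfold kerK at hker ⊢; rw [hu', lin_mod]; exact hker
    rw [← transWK_mod_two_pow nb da db u] at h
    have hlg' : kerK lg (nb * (l * m)) u' :=
      (lgZero_transWK_iff hl hm hQx hQy hLx hLy da db hu'lt hker').2 (h (kerK_transWK_of_gens hl hm hQx hQy da db u' hker'))
    unfold kerK at hlg' ⊢; rw [hu', lin_mod] at hlg'; exact hlg'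
  · exact Or.inr (matchedK_of_matchedK_transWK hl hm h)

omit hl hm in
/-- `QTop` holds at the zero word. -/
theorem qTop_zero {nb : ℕ} {syn lg : ℕ → ℕ} {TOPS : List ℕ} : QTop l m nb syn lg TOPS 0 :=
  Or.inl fun _ => by unfold kerK; exact lin_zero _ _ _

end Top

/-! ## The induction -/

section Induction

variable {G : Geo} {nb : ℕ}

/-- **INDUCTION STEP of the nested tower**: if every small kernel word of weight `≤ W` has the fibre property `GoodFibK … Q`,
every big kernel word of weight `≤ W` satisfies `Q` (its fold is such a small word: S2 + weight monotonicity). -/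
theorem level_sound (hG : OKK G nb) {colB colS : ℕ → ℕ} {R : List ℕ} (hR : RowCompat G nb colB colS R) {W : ℕ}
    {Q : ℕ → Prop} (hsmall : ∀ s, s < 2 ^ nsK G nb → kerK colS (nsK G nb) s → popc (nsK G nb) s ≤ W → GoodFibK G nb colB W Q s) :
    ∀ u, u < 2 ^ nK G nb → kerK colB (nK G nb) u → popc (nK G nb) u ≤ W → Q u := by
  intro u hu hker hwt
  exact hsmall (foldWK G nb u) (foldWK_lt hG u) (kerK_foldWK hG hR hker) ((popc_foldWK_le hG hu).trans hwt)
    u hu hker hwt rfl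

/-- **BASE of the nested tower**: a base certificate (`s = 0`, or a translate of a listed `t`), the unit facts at the listed `t`
(as fibre properties), and the zero fibre give the fibre property at every small kernel word of weight `≤ W`. -/
theorem base_sound (hS : G.Shape) (hG : OKK G nb) {colB colS : ℕ → ℕ}
    (hK : ∀ da db u, u < 2 ^ nK G nb → (kerK colB (nK G nb) u ↔ kerK colB (nK G nb) (transWK G.l G.m nb da db u)))
    {W : ℕ} {T : List ℕ} {Q : ℕ → Prop} (hQ : ∀ da db u, Q (transWK G.l G.m nb da db u) → Q u)
    (hbase : ∀ s, s < 2 ^ nsK G nb → kerK colS (nsK G nb) s → popc (nsK G nb) s ≤ W → s = 0 ∨ MatchedK G.ls G.ms nb T s)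
    (hunits : ∀ t ∈ T, GoodFibK G nb colB W Q t) (hzero : GoodFibK G nb colB W Q 0) :
    ∀ s, s < 2 ^ nsK G nb → kerK colS (nsK G nb) s → popc (nsK G nb) s ≤ W → GoodFibK G nb colB W Q s := by
  intro s hs hker hwt
  rcases hbase s hs hker hwt with rfl | ⟨t, ht, da, db, htr⟩
  · exact hzero
  · have hgood : GoodFibK G nb colB W Q (transWK G.ls G.ms nb da db s) := by rw [htr]; exact hunits t ht
    exact goodFibK_of_trans hS hG (hK da db) (hQ da db) hgood

/-- Transport of a fibre property from a representative: if `s` translates onto `r` and the fibre over `r` is good, so is the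
fibre over `s` (for the special low-weight classes certified window by window). -/
theorem goodFibK_of_matched (hS : G.Shape) (hG : OKK G nb) {col : ℕ → ℕ}
    (hK : ∀ da db u, u < 2 ^ nK G nb → (kerK col (nK G nb) u ↔ kerK col (nK G nb) (transWK G.l G.m nb da db u)))
    {W : ℕ} {Q : ℕ → Prop} (hQ : ∀ da db u, Q (transWK G.l G.m nb da db u) → Q u) {reps : List ℕ}
    (hreps : ∀ r ∈ reps, GoodFibK G nb col W Q r) {s : ℕ} (hs : MatchedK G.ls G.ms nb reps s) : GoodFibK G nb col W Q s := by
  obtain ⟨r, hr, da, db, htr⟩ := hs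
  have hgood : GoodFibK G nb col W Q (transWK G.ls G.ms nb da db s) := by rw [htr]; exact hreps r hr
  exact goodFibK_of_trans hS hG (hK da db) (hQ da db) hgood

/-- A fibre property is closed under un-translating its (small) base word when `Q` is and the kernel is invariant — so the
nested predicates `N_k := GoodFibK … N_{k−1}` inherit translation closure level by level. -/
theorem goodFibK_transWK_closed (hS : G.Shape) (hG : OKK G nb) {col : ℕ → ℕ}
    (hK : ∀ da db u, u < 2 ^ nK G nb → (kerK col (nK G nb) u ↔ kerK col (nK G nb) (transWK G.l G.m nb da db u)))
    {W : ℕ} {Q : ℕ → Prop} (hQ : ∀ da db u, Q (transWK G.l G.m nb da db u) → Q u) :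
    ∀ da db v, GoodFibK G nb col W Q (transWK G.ls G.ms nb da db v) → GoodFibK G nb col W Q v :=
  fun da db _ h => goodFibK_of_trans hS hG (hK da db) (hQ da db) h


/-! ## The three-step nested tower, composed (CARD-7 shape: base `A`, then `B`, then `C` = top) -/

/-- **THE NESTED TOWER, COMPOSED.**  Three fold steps `A` (base) → `B` → `C` (top) on `nb` blocks, chained
(`nsK C = nK B`, `nsK B = nK A`, small torus of each = big torus of the next), column tables `col0` (top, big of `C`) …
`col3` (base, small of `A`), row-compatibility data per step (S2), kernel translation-invariance per big table (S4/N1), the top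
predicate `QT` closed under un-translating with `QT 0`; THEN: a base certificate for `col3` (`hbase`, S6), the base UNIT facts
read as fibre properties (`hunits`, via `nodeK_sound`), and the zero fibre of step `A` (`hzeroA`, via `goodFibK_zero`, whose
own `Q 0` is the zero fibre of `B`, whose `Q 0` is the zero fibre of `C`) give the top property for EVERY top kernel word of
weight `≤ W` — the kernel-completeness statement `KC` the bridge (S7) consumes. -/
theorem kc_of_tower {nb W : ℕ} {GA GB GC : Geo} (hSA : GA.Shape) (hSB : GB.Shape) (hSC : GC.Shape)
    (hGA : OKK GA nb) (hGB : OKK GB nb) (hGC : OKK GC nb)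
    (hBA : GB.ls = GA.l ∧ GB.ms = GA.m) (hCB : GC.ls = GB.l ∧ GC.ms = GB.m)
    {col0 col1 col2 col3 : ℕ → ℕ} {RA RB RC : List ℕ}
    (hRA : RowCompat GA nb col2 col3 RA) (hRB : RowCompat GB nb col1 col2 RB) (hRC : RowCompat GC nb col0 col1 RC)
    (hK2 : ∀ da db u, u < 2 ^ nK GA nb → (kerK col2 (nK GA nb) u ↔ kerK col2 (nK GA nb) (transWK GA.l GA.m nb da db u)))
    (hK1 : ∀ da db u, u < 2 ^ nK GB nb → (kerK col1 (nK GB nb) u ↔ kerK col1 (nK GB nb) (transWK GB.l GB.m nb da db u)))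
    (hK0 : ∀ da db u, u < 2 ^ nK GC nb → (kerK col0 (nK GC nb) u ↔ kerK col0 (nK GC nb) (transWK GC.l GC.m nb da db u)))
    {QT : ℕ → Prop} (hQT : ∀ da db u, QT (transWK GC.l GC.m nb da db u) → QT u)
    {T3 : List ℕ}
    (hbase : ∀ s, s < 2 ^ nsK GA nb → kerK col3 (nsK GA nb) s → popc (nsK GA nb) s ≤ W → s = 0 ∨ MatchedK GA.ls GA.ms nb T3 s)
    (hunits : ∀ t ∈ T3, GoodFibK GA nb col2 W (GoodFibK GB nb col1 W (GoodFibK GC nb col0 W QT)) t)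
    (hzeroA : GoodFibK GA nb col2 W (GoodFibK GB nb col1 W (GoodFibK GC nb col0 W QT)) 0) :
    ∀ u, u < 2 ^ nK GC nb → kerK col0 (nK GC nb) u → popc (nK GC nb) u ≤ W → QT u := by
  -- window identities between the levels
  have eCB : nsK GC nb = nK GB nb := by unfold nsK nK; rw [hCB.1, hCB.2]
  have eBA : nsK GB nb = nK GA nb := by unfold nsK nK; rw [hBA.1, hBA.2]
  -- translation closure of the nested predicates
  have hNC : ∀ da db v, GoodFibK GC nb col0 W QT (transWK GB.l GB.m nb da db v) → GoodFibK GC nb col0 W QT v := by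
    intro da db v h
    rw [← hCB.1, ← hCB.2] at h
    exact goodFibK_transWK_closed hSC hGC hK0 hQT da db v h
  have hNB : ∀ da db v, GoodFibK GB nb col1 W (GoodFibK GC nb col0 W QT) (transWK GA.l GA.m nb da db v) →
      GoodFibK GB nb col1 W (GoodFibK GC nb col0 W QT) v := by
    intro da db v h
    rw [← hBA.1, ← hBA.2] at h
    exact goodFibK_transWK_closed hSB hGB hK1 hNC da db v h
  -- base level A
  have P3 := base_sound hSA hGA hK2 hNB hbase hunits hzeroA
  -- step A: every kernel word of col2 (= small words of B) has the B-fibre property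
  have P2 := level_sound hGA hRA P3
  -- step B
  have P2' : ∀ s, s < 2 ^ nsK GB nb → kerK col2 (nsK GB nb) s → popc (nsK GB nb) s ≤ W →
      GoodFibK GB nb col1 W (GoodFibK GC nb col0 W QT) s := by rw [eBA]; exact P2
  have P1 := level_sound hGB hRB P2'
  -- step C
  have P1' : ∀ s, s < 2 ^ nsK GC nb → kerK col1 (nsK GC nb) s → popc (nsK GC nb) s ≤ W →
      GoodFibK GC nb col0 W QT s := by rw [eCB]; exact P1
  exact level_sound hGC hRC P1'

end Induction

end Summit.Ventures.QEC.CircuitDistance.ETower
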